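import Summits.ResolutionOfSingularities.ResolutionOfSingularities.Theorems.FrobeniusLadderFInjectiveMacaulayficationCNCylinder
import Summits.ResolutionOfSingularities.ResolutionOfSingularities.Theorems.FrobeniusLadderFInjectiveMacaulayficationPolynomialLocalizationClauseAtPrime
import Mathlib.RingTheory.Jacobson.Ring
import Mathlib.RingTheory.Polynomial.Quotient
import HarnessLib

/-!
# `hoff ⇒ hoff′`: the clause off the axis of the cylinder `Spec k[X_{n+1}]/(f)` follows from the clause off the origin of
# `Spec k[X_n]/(f)` — the cylinder step `CNCylinder.strongPlusStep_cylinder_of_cnData` with the ABSOLUTE side hypothesis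
# (crux `FInjectiveMacaulayfication` stmt-ResolutionOfSingularities-15315, chain w45a, hole #3; pool item W4.5a U6
# `CylinderHoffDischarge`, res-L1-w45a-plan-1 R12.14 (c) / R9.4 (b); owner res-D-pv-017 AS res-L1-w45a-stub-5)

Support file for crux stmt-ResolutionOfSingularities-15315 (`FrobeniusLadder.FInjectiveMacaulayfication`), chain w45a.
[OURS · L1 W4.5a] — NOT a statement of any manuscript; AI-written, weaker than expert review.

* `clause_polynomial_atPrime_of_comap` — the clause (every system of parameters weakly regular, parameter ideals Frobenius
  closed) ascends from `A_{P ∩ A}` to `A[t]_P` for ONE prime `P` of `A[t]` (`A` Noetherian of characteristic `p`; every residue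
  field): the pointwise form of `PolynomialLocalizationClause.clause_polynomial_atPrime` (same proof, which only ever used the
  clause at `P ∩ A`).
* `exists_cylinderEquiv` — `k[X_{n+1}]/(rename succ f) ≃+* (k[X_n]/(f))[t]`, `x̄_{succ j} ↦ C x̄_j`, `x̄_0 ↦ t`.
* `clause_atMaximal_of_ringEquiv_polynomial` / `hoff'_of_hoff` — if the clause holds at the maximal ideals of
  `R = k[X_n]/(f)` off `V(x̄_1,…,x̄_n)` then it holds at the maximal ideals of the cylinder `R' = k[X_{n+1}]/(rename succ f)` off
  the axis `V(x̄_{succ j})`: a maximal `Q'` of `R' ≅ R[t]` contracts to a MAXIMAL ideal `q` of `R` (`R` is Jacobson: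
  `Polynomial.isMaximal_comap_C_of_isJacobsonRing`) still off the origin, and the clause ascends `R_q ⇝ R[t]_{Q}` by
  `clause_polynomial_atPrime_of_comap` (the abstract form keeps one instance path per ring).
* `strongPlusStep_cylinder_of_cnData'` — `CNCylinder.strongPlusStep_cylinder_of_cnData` (p503342) with its only cylinder-side
  hypothesis `hoff′` replaced by the absolute `hoff` of the CN engine `CNConeFiModelPrime.cnConeFiModel_of_isPrime`: the
  cylinder over ANY Cartier–Newton point model inherits a STRONG⁺ confined iso-step at the generic point of its axis from exactly
  the data of the point model.
No definitions, no named facts. [folklore]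
-/

-- single-problem summit: the doubled namespace component is forced
set_option linter.dupNamespace false

noncomputable section

open Polynomial IsLocalRing RingTheory.Sequence AlgebraicGeometry CategoryTheory Literature.AlgebraicGeometry.Resolution

namespace Summit.ResolutionOfSingularities.ResolutionOfSingularities.Theorems.FInjectiveMacaulayfication.CylinderHoffDischarge

open Summit.ResolutionOfSingularities.ResolutionOfSingularities.Theorems.FInjectiveMacaulayfication

/-! ## §1 The clause ascends from `A_{P ∩ A}` to `A[t]_P` -/

set_option maxHeartbeats 800000 in
/-- **The clause ascends from `A_{P ∩ A}` to `A[t]_P`** (`A` Noetherian of characteristic `p`, `P` a prime of `A[t]`; every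
residue field): `A[t]_P ≅ (A_𝔭[t])_{P'}` with `𝔭 = P ∩ A` and `PolynomialLocalizationClause.clause_polynomial_localization`
over the local ring `A_𝔭`. Pointwise form of `PolynomialLocalizationClause.clause_polynomial_atPrime`. [folklore] -/
theorem clause_polynomial_atPrime_of_comap (p : ℕ) [Fact p.Prime] (A : Type) [CommRing A] [IsNoetherianRing A] [CharP A p]
    (P : Ideal A[X]) [P.IsPrime]
    (hA : ∀ d : ℕ, ringKrullDim (Localization.AtPrime (P.comap (C : A →+* A[X]))) = d →
      ∀ s : Fin d → Localization.AtPrime (P.comap (C : A →+* A[X])), (Ideal.span (Set.range s)).radical.IsMaximal →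
        IsWeaklyRegular (Localization.AtPrime (P.comap (C : A →+* A[X]))) (List.ofFn s) ∧
        ∀ y : Localization.AtPrime (P.comap (C : A →+* A[X])), (∃ e : ℕ, y ^ p ^ e ∈ Ideal.span
          ((fun z : Localization.AtPrime (P.comap (C : A →+* A[X])) => z ^ p ^ e) ''
            (Ideal.span (Set.range s) : Set (Localization.AtPrime (P.comap (C : A →+* A[X])))))) →
          y ∈ Ideal.span (Set.range s)) :
    ∀ d : ℕ, ringKrullDim (Localization.AtPrime P) = d → ∀ s : Fin d → Localization.AtPrime P,
      (Ideal.span (Set.range s)).radical.IsMaximal →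
      IsWeaklyRegular (Localization.AtPrime P) (List.ofFn s) ∧
      ∀ y : Localization.AtPrime P, (∃ e : ℕ, y ^ p ^ e ∈ Ideal.span
        ((fun z : Localization.AtPrime P => z ^ p ^ e) ''
          (Ideal.span (Set.range s) : Set (Localization.AtPrime P)))) → y ∈ Ideal.span (Set.range s) := by
  -- `𝔭 = P ∩ A`, `S = A_𝔭[t]` a localization of `A[t]`
  set 𝔭 : Ideal A := P.comap (C : A →+* A[X]) with h𝔭
  haveI : CharP (Localization.AtPrime 𝔭) p := DegreeZeroDescent.charP_localization_atPrime p 𝔭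
  letI algS : Algebra A[X] (Localization.AtPrime 𝔭)[X] := Polynomial.algebra A (Localization.AtPrime 𝔭)
  haveI hS : IsLocalization (𝔭.primeCompl.map (C : A →+* A[X])) (Localization.AtPrime 𝔭)[X] :=
    Polynomial.isLocalization 𝔭.primeCompl (Localization.AtPrime 𝔭)
  have halgS : ∀ f : A[X], algebraMap A[X] (Localization.AtPrime 𝔭)[X] f = f.map (algebraMap A (Localization.AtPrime 𝔭)) :=
    fun f => rfl
  have hdisj : Disjoint (↑(𝔭.primeCompl.map (C : A →+* A[X])) : Set A[X]) (↑P : Set A[X]) := by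
    rw [Set.disjoint_left]
    rintro _ ⟨a, ha, rfl⟩ haP
    exact ha haP
  -- `P' = P·S`, a prime of `S` over `P` and over the maximal ideal of `A_𝔭`
  haveI hP' : (P.map (algebraMap A[X] (Localization.AtPrime 𝔭)[X])).IsPrime :=
    IsLocalization.isPrime_of_isPrime_disjoint (𝔭.primeCompl.map (C : A →+* A[X])) (Localization.AtPrime 𝔭)[X] P
      inferInstance hdisj
  have hunder : (P.map (algebraMap A[X] (Localization.AtPrime 𝔭)[X])).comap (algebraMap A[X] (Localization.AtPrime 𝔭)[X]) = P :=
    IsLocalization.under_map_of_isPrime_disjoint (𝔭.primeCompl.map (C : A →+* A[X])) (Localization.AtPrime 𝔭)[X]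
      inferInstance hdisj
  have hP'c : (P.map (algebraMap A[X] (Localization.AtPrime 𝔭)[X])).comap (C : Localization.AtPrime 𝔭 →+* (Localization.AtPrime 𝔭)[X]) =
      maximalIdeal (Localization.AtPrime 𝔭) := by
    have hcomp : (C : Localization.AtPrime 𝔭 →+* (Localization.AtPrime 𝔭)[X]).comp (algebraMap A (Localization.AtPrime 𝔭)) =
        (algebraMap A[X] (Localization.AtPrime 𝔭)[X]).comp (C : A →+* A[X]) :=
      RingHom.ext fun a => by rw [RingHom.comp_apply, RingHom.comp_apply, halgS, map_C]
    have h1 : ((P.map (algebraMap A[X] (Localization.AtPrime 𝔭)[X])).comap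
        (C : Localization.AtPrime 𝔭 →+* (Localization.AtPrime 𝔭)[X])).under A = 𝔭 := by
      rw [Ideal.under_def, Ideal.comap_comap, hcomp, ← Ideal.comap_comap, hunder]
    calc (P.map (algebraMap A[X] (Localization.AtPrime 𝔭)[X])).comap (C : Localization.AtPrime 𝔭 →+* (Localization.AtPrime 𝔭)[X])
        = (((P.map (algebraMap A[X] (Localization.AtPrime 𝔭)[X])).comap
            (C : Localization.AtPrime 𝔭 →+* (Localization.AtPrime 𝔭)[X])).under A).map (algebraMap A (Localization.AtPrime 𝔭)) :=
          (IsLocalization.map_under (M := 𝔭.primeCompl) (S := Localization.AtPrime 𝔭) _).symm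
      _ = 𝔭.map (algebraMap A (Localization.AtPrime 𝔭)) := by rw [h1]
      _ = maximalIdeal (Localization.AtPrime 𝔭) := IsLocalization.AtPrime.map_eq_maximalIdeal 𝔭 _
  -- the clause at `T = S_{P'}`
  have hT := PolynomialLocalizationClause.clause_polynomial_localization p (Localization.AtPrime 𝔭) hA
    (P.map (algebraMap A[X] (Localization.AtPrime 𝔭)[X])) hP'c
  -- `T` is the localization of `A[t]` at `P`
  haveI : IsLocalization.AtPrime (Localization.AtPrime (P.map (algebraMap A[X] (Localization.AtPrime 𝔭)[X]))) P := by
    have h := IsLocalization.isLocalization_isLocalization_atPrime_isLocalization (𝔭.primeCompl.map (C : A →+* A[X]))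
      (T := Localization.AtPrime (P.map (algebraMap A[X] (Localization.AtPrime 𝔭)[X])))
      (P.map (algebraMap A[X] (Localization.AtPrime 𝔭)[X]))
    have hM : ((P.map (algebraMap A[X] (Localization.AtPrime 𝔭)[X])).comap
        (algebraMap A[X] (Localization.AtPrime 𝔭)[X])).primeCompl = P.primeCompl := by
      ext x
      rw [Ideal.mem_primeCompl_iff, Ideal.mem_primeCompl_iff, hunder]
    change IsLocalization P.primeCompl _
    rw [← hM]
    exact h
  let e : Localization.AtPrime (P.map (algebraMap A[X] (Localization.AtPrime 𝔭)[X])) ≃+* Localization.AtPrime P :=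
    (IsLocalization.algEquiv P.primeCompl
      (Localization.AtPrime (P.map (algebraMap A[X] (Localization.AtPrime 𝔭)[X]))) (Localization.AtPrime P)).toRingEquiv
  exact DegreeZeroDescent.inlineClause_of_ringEquiv
    (L := Localization.AtPrime (P.map (algebraMap A[X] (Localization.AtPrime 𝔭)[X]))) (L' := Localization.AtPrime P) p e hT

/-! ## §2 The cylinder ring is a polynomial ring -/

/-- **`k[X_{n+1}]/(rename succ f) ≃+* (k[X_n]/(f))[t]`** with `x̄_{succ j} ↦ C x̄_j` and `x̄_0 ↦ t` (`finSuccEquiv`, then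
`k[X_n][t]/(C f) = k[X_n][t]/((f)·k[X_n][t]) ≅ (k[X_n]/(f))[t]`, `Ideal.polynomialQuotientEquivQuotientPolynomial`). [folklore] -/
theorem exists_cylinderEquiv {k : Type} [CommRing k] {n : ℕ} (f : MvPolynomial (Fin n) k) :
    ∃ e : (MvPolynomial (Fin (n + 1)) k ⧸ Ideal.span {MvPolynomial.rename Fin.succ f}) ≃+*
        (MvPolynomial (Fin n) k ⧸ Ideal.span {f})[X],
      (∀ j : Fin n, e (Ideal.Quotient.mk _ (MvPolynomial.X j.succ)) = C (Ideal.Quotient.mk _ (MvPolynomial.X j))) ∧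
      e (Ideal.Quotient.mk _ (MvPolynomial.X 0)) = X := by
  have hJ : (Ideal.span {(C f : (MvPolynomial (Fin n) k)[X])}) =
      (Ideal.span {MvPolynomial.rename Fin.succ f}).map
        ((MvPolynomial.finSuccEquiv k n).toRingEquiv : MvPolynomial (Fin (n + 1)) k →+* (MvPolynomial (Fin n) k)[X]) := by
    rw [Ideal.map_span, Set.image_singleton]
    congr 2
    exact (CNCylinder.finSuccEquiv_rename_succ f).symm
  have hI : (Ideal.span {(C f : (MvPolynomial (Fin n) k)[X])}) = (Ideal.span {f}).map (C : MvPolynomial (Fin n) k →+* _) := by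
    rw [Ideal.map_span, Set.image_singleton]
  let e₁ := Ideal.quotientEquiv (Ideal.span {MvPolynomial.rename Fin.succ f}) (Ideal.span {(C f : (MvPolynomial (Fin n) k)[X])})
    (MvPolynomial.finSuccEquiv k n).toRingEquiv hJ
  let e₂ := Ideal.quotEquivOfEq hI
  let e₃ := (Ideal.polynomialQuotientEquivQuotientPolynomial (Ideal.span {f})).symm
  refine ⟨e₁.trans (e₂.trans e₃), fun j => ?_, ?_⟩
  · show e₃ (e₂ (e₁ (Ideal.Quotient.mk _ (MvPolynomial.X j.succ)))) = _
    rw [Ideal.quotientEquiv_mk, Ideal.quotEquivOfEq_mk, Ideal.polynomialQuotientEquivQuotientPolynomial_symm_mk]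
    change ((MvPolynomial.finSuccEquiv k n) (MvPolynomial.X j.succ)).map _ = _
    rw [MvPolynomial.finSuccEquiv_X_succ, Polynomial.map_C]
  · show e₃ (e₂ (e₁ (Ideal.Quotient.mk _ (MvPolynomial.X 0)))) = _
    rw [Ideal.quotientEquiv_mk, Ideal.quotEquivOfEq_mk, Ideal.polynomialQuotientEquivQuotientPolynomial_symm_mk]
    change ((MvPolynomial.finSuccEquiv k n) (MvPolynomial.X 0)).map _ = _
    rw [MvPolynomial.finSuccEquiv_X_zero, Polynomial.map_X]

/-! ## §3 `hoff ⇒ hoff′` -/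

/-- **The clause at a maximal ideal of a ring `R' ≅ B[t]` off `V(x)`** from the clause at the maximal ideals of `B` off `V(x)`
(`B` Noetherian, Jacobson, of characteristic `p`; `x' ∈ R'` corresponds to `C x`): the maximal ideal contracts to a MAXIMAL ideal
of `B` (`Polynomial.isMaximal_comap_C_of_isJacobsonRing`) not containing `x`, and the clause ascends by
`clause_polynomial_atPrime_of_comap`. Stated over abstract rings (one instance path per ring). [folklore] -/
theorem clause_atMaximal_of_ringEquiv_polynomial (p : ℕ) [Fact p.Prime] {R' B : Type} [CommRing R'] [CommRing B]
    [IsNoetherianRing B] [CharP B p] [IsJacobsonRing B] (e : R' ≃+* B[X]) (x : B) (x' : R') (hx : e x' = C x)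
    (hB : ∀ (q : Ideal B) [q.IsMaximal], x ∉ q →
      ∀ d : ℕ, ringKrullDim (Localization.AtPrime q) = d → ∀ s : Fin d → Localization.AtPrime q,
        (Ideal.span (Set.range s)).radical.IsMaximal →
          IsWeaklyRegular (Localization.AtPrime q) (List.ofFn s) ∧
          ∀ y : Localization.AtPrime q, (∃ e : ℕ, y ^ p ^ e ∈ Ideal.span
            ((fun z : Localization.AtPrime q => z ^ p ^ e) ''
              (Ideal.span (Set.range s) : Set (Localization.AtPrime q)))) → y ∈ Ideal.span (Set.range s))
    (Q' : Ideal R') [Q'.IsMaximal] (hx' : x' ∉ Q') :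
    ∀ d : ℕ, ringKrullDim (Localization.AtPrime Q') = d → ∀ s : Fin d → Localization.AtPrime Q',
      (Ideal.span (Set.range s)).radical.IsMaximal →
        IsWeaklyRegular (Localization.AtPrime Q') (List.ofFn s) ∧
        ∀ y : Localization.AtPrime Q', (∃ e : ℕ, y ^ p ^ e ∈ Ideal.span
          ((fun z : Localization.AtPrime Q' => z ^ p ^ e) ''
            (Ideal.span (Set.range s) : Set (Localization.AtPrime Q')))) → y ∈ Ideal.span (Set.range s) := by
  -- `Q = e(Q')` is maximal, `q = Q ∩ B` is maximal and misses `x`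
  obtain ⟨Q, hQdef⟩ : ∃ Q : Ideal B[X], Q = Q'.comap e.symm.toRingHom := ⟨_, rfl⟩
  have hmemQ : ∀ y : R', e y ∈ Q ↔ y ∈ Q' := fun y => by
    rw [hQdef, Ideal.mem_comap, RingEquiv.toRingHom_eq_coe, RingHom.coe_coe, RingEquiv.symm_apply_apply]
  haveI hQmax : Q.IsMaximal := hQdef ▸ Ideal.comap_isMaximal_of_equiv e.symm
  haveI hq : (Q.comap (C : B →+* B[X])).IsMaximal := Polynomial.isMaximal_comap_C_of_isJacobsonRing Q
  have hxq : x ∉ Q.comap (C : B →+* B[X]) := by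
    intro h
    rw [Ideal.mem_comap, ← hx, hmemQ] at h
    exact hx' h
  -- the clause at `B_q`, ascended to `B[t]_Q`, transported to `R'_{Q'}`
  have hclQ := clause_polynomial_atPrime_of_comap p B Q (hB (Q.comap (C : B →+* B[X])) hxq)
  obtain ⟨eL⟩ := BlowupFiModelOfCover.nonempty_ringEquiv_localization_of_ringEquiv e Q' Q hmemQ
  exact DegreeZeroDescent.inlineClause_of_ringEquiv (L := Localization.AtPrime Q) (L' := Localization.AtPrime Q') p eL.symm hclQ

set_option maxHeartbeats 800000 in
/-- **The clause off the origin of `Spec k[X_n]/(f)` (at maximal ideals) gives the clause off the axis of the cylinder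
`Spec k[X_{n+1}]/(rename succ f)` (at maximal ideals).** `clause_atMaximal_of_ringEquiv_polynomial` along the cylinder
isomorphism `exists_cylinderEquiv`, with `B = k[X_n]/(f)` (Noetherian, Jacobson, characteristic `p`) and `x = x̄_j`. [folklore] -/
theorem hoff'_of_hoff (p : ℕ) [Fact p.Prime] (k : Type) [Field k] [CharP k p] (n : ℕ) (f : MvPolynomial (Fin n) k)
    (hfprime : (Ideal.span {f}).IsPrime)
    (hoff : ∀ (Q : Ideal (MvPolynomial (Fin n) k ⧸ Ideal.span {f})) [Q.IsMaximal],
      (∃ j : Fin n, Ideal.Quotient.mk (Ideal.span {f}) (MvPolynomial.X j) ∉ Q) →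
      ∀ d : ℕ, ringKrullDim (Localization.AtPrime Q) = d → ∀ s : Fin d → Localization.AtPrime Q,
        (Ideal.span (Set.range s)).radical.IsMaximal →
          IsWeaklyRegular (Localization.AtPrime Q) (List.ofFn s) ∧
          ∀ y : Localization.AtPrime Q, (∃ e : ℕ, y ^ p ^ e ∈ Ideal.span
            ((fun z : Localization.AtPrime Q => z ^ p ^ e) ''
              (Ideal.span (Set.range s) : Set (Localization.AtPrime Q)))) → y ∈ Ideal.span (Set.range s)) :
    ∀ (Q : Ideal (MvPolynomial (Fin (n + 1)) k ⧸ Ideal.span {MvPolynomial.rename Fin.succ f})) [Q.IsMaximal],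
      (∃ j : Fin n, Ideal.Quotient.mk (Ideal.span {MvPolynomial.rename Fin.succ f}) (MvPolynomial.X j.succ) ∉ Q) →
      ∀ d : ℕ, ringKrullDim (Localization.AtPrime Q) = d → ∀ s : Fin d → Localization.AtPrime Q,
        (Ideal.span (Set.range s)).radical.IsMaximal →
          IsWeaklyRegular (Localization.AtPrime Q) (List.ofFn s) ∧
          ∀ y : Localization.AtPrime Q, (∃ e : ℕ, y ^ p ^ e ∈ Ideal.span
            ((fun z : Localization.AtPrime Q => z ^ p ^ e) ''
              (Ideal.span (Set.range s) : Set (Localization.AtPrime Q)))) → y ∈ Ideal.span (Set.range s) := by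
  intro Q' _ hQ'
  obtain ⟨j, hj⟩ := hQ'
  -- `B = k[X_n]/(f)`: Noetherian, Jacobson, characteristic `p`
  haveI : Nontrivial (MvPolynomial (Fin n) k ⧸ Ideal.span {f}) := Ideal.Quotient.nontrivial_iff.mpr hfprime.ne_top
  haveI : CharP (MvPolynomial (Fin n) k ⧸ Ideal.span {f}) p :=
    charP_of_injective_algebraMap (algebraMap k (MvPolynomial (Fin n) k ⧸ Ideal.span {f})).injective p
  haveI : IsJacobsonRing (MvPolynomial (Fin n) k ⧸ Ideal.span {f}) := inferInstance
  obtain ⟨e, hesucc, -⟩ := exists_cylinderEquiv f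
  exact clause_atMaximal_of_ringEquiv_polynomial p e (Ideal.Quotient.mk (Ideal.span {f}) (MvPolynomial.X j))
    (Ideal.Quotient.mk (Ideal.span {MvPolynomial.rename Fin.succ f}) (MvPolynomial.X j.succ)) (hesucc j)
    (fun q hq hxq => @hoff q hq ⟨j, hxq⟩) Q' hj

/-! ## §4 The cylinder step from ABSOLUTE Cartier–Newton data -/

set_option maxHeartbeats 1600000 in
/-- **CN DATA × 𝔸¹ ⇒ A STRONG⁺ STEP AT THE GENERIC POINT OF THE AXIS — from the ABSOLUTE data of the point model only.**
`CNCylinder.strongPlusStep_cylinder_of_cnData` (p503342) with its cylinder-side hypothesis `hoff′` (the clause at the maximal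
ideals of `k[X_{n+1}]/(rename succ f)` off the axis) replaced by the point model's `hoff` (the clause at the maximal ideals of
`k[X_n]/(f)` off the origin — the very hypothesis of `CNConeFiModelPrime.cnConeFiModel_of_isPrime`), via `hoff'_of_hoff`.
[folklore] -/
theorem strongPlusStep_cylinder_of_cnData' (p : ℕ) [Fact p.Prime] (k : Type) [Field k] [CharP k p] (n : ℕ) (hn : 0 < n)
    (A : Finset (Fin n →₀ ℕ)) (hA0 : (0 : Fin n →₀ ℕ) ∉ A)
    (hprim : ∀ j : Fin n, ∃ e : ℕ, 0 < e ∧ Finsupp.single j e ∈ A)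
    (t : ℕ) (ht : 0 < t) (V : Fin t → Matrix (Fin n) (Fin n) ℕ) (hV : ∀ c, IsUnit ((V c).map (Nat.cast : ℕ → ℤ)).det)
    (m : Fin t → (Fin n →₀ ℕ)) (hm : ∀ c, m c ∈ A) (a : Fin t → Fin n → (Fin n →₀ ℕ)) (haA : ∀ c i, a c i ∈ A)
    (hgen : ∀ (c : Fin t) (i : Fin n), (Finsupp.equivFunOnFinite.symm ((V c).mulVec ⇑(a c i)) : Fin n →₀ ℕ) =
      Finsupp.equivFunOnFinite.symm ((V c).mulVec ⇑(m c)) + Finsupp.single i 1)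
    (hge : ∀ (c : Fin t), ∀ e ∈ A, (Finsupp.equivFunOnFinite.symm ((V c).mulVec ⇑(m c)) : Fin n →₀ ℕ) ≤
      Finsupp.equivFunOnFinite.symm ((V c).mulVec ⇑e))
    (hcov : ∀ e ∈ A, ∃ (c : Fin t) (K : ℕ), 1 ≤ K ∧ ∃ y ∈ (Ideal.span ((fun b : Fin n →₀ ℕ => (MvPolynomial.monomial b (1 : k) : MvPolynomial (Fin n) k)) '' (A : Set (Fin n →₀ ℕ)))) ^ (K - 1),
      (MvPolynomial.monomial e (1 : k) : MvPolynomial (Fin n) k) ^ K = MvPolynomial.monomial (m c) 1 * y)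
    (f : MvPolynomial (Fin n) k) (hfprime : (Ideal.span {f}).IsPrime)
    (hXne : ∀ v : Fin n, Ideal.Quotient.mk (Ideal.span {f}) (MvPolynomial.X v) ≠ 0)
    (hoff : ∀ (Q : Ideal (MvPolynomial (Fin n) k ⧸ Ideal.span {f})) [Q.IsMaximal],
      (∃ j : Fin n, Ideal.Quotient.mk (Ideal.span {f}) (MvPolynomial.X j) ∉ Q) →
      ∀ d : ℕ, ringKrullDim (Localization.AtPrime Q) = d → ∀ s : Fin d → Localization.AtPrime Q,
        (Ideal.span (Set.range s)).radical.IsMaximal →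
          RingTheory.Sequence.IsWeaklyRegular (Localization.AtPrime Q) (List.ofFn s) ∧
          ∀ y : Localization.AtPrime Q, (∃ e : ℕ, y ^ p ^ e ∈ Ideal.span
            ((fun z : Localization.AtPrime Q => z ^ p ^ e) ''
              (Ideal.span (Set.range s) : Set (Localization.AtPrime Q)))) → y ∈ Ideal.span (Set.range s))
    (hCN : ∀ (c : Fin t) (S : Finset (Fin n)), (∀ j : Fin n, 0 < ∑ i ∈ S, V c i j) →
      (∀ D : ℕ, (MvPolynomial.weightedHomogeneousComponent (fun j : Fin n => ∑ i ∈ S, V c i j) D f ≠ 0 ∧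
          ∀ D' < D, MvPolynomial.weightedHomogeneousComponent (fun j : Fin n => ∑ i ∈ S, V c i j) D' f = 0) →
        ∀ (K : Type) [Field K] [Algebra k K] (b : Fin n → K), (∀ i, b i ≠ 0) →
          MvPolynomial.aeval b (MvPolynomial.weightedHomogeneousComponent (fun j : Fin n => ∑ i ∈ S, V c i j) D f) = 0 →
          (MvPolynomial.map (algebraMap k K) (MvPolynomial.weightedHomogeneousComponent (fun j : Fin n => ∑ i ∈ S, V c i j) D f)) ^ (p - 1) ∉
            Ideal.span (Set.range fun i : Fin n => (MvPolynomial.X i - MvPolynomial.C (b i)) ^ p)))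
    (dv : Fin t → (Fin n →₀ ℕ)) (g : Fin t → MvPolynomial (Fin n) k)
    (hg : ∀ c, MvPolynomial.aeval (fun j : Fin n => ∏ i : Fin n, (MvPolynomial.X i : MvPolynomial (Fin n) k) ^ V c i j) f = MvPolynomial.monomial (dv c) 1 * g c)
    (hndiv : ∀ c, ∀ i : Fin n, ¬ (MvPolynomial.X i ∣ g c))
    (hface : ∀ c, ∃ m ∈ f.support, ∀ i : Fin n, ∑ j : Fin n, V c i j * m j = dv c i)
    (η : ↥(Spec (.of (MvPolynomial (Fin (n + 1)) k ⧸ Ideal.span {MvPolynomial.rename Fin.succ f}))))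
    (hη : η.asIdeal = Ideal.span (Set.range fun j : Fin n =>
      Ideal.Quotient.mk (Ideal.span {MvPolynomial.rename Fin.succ f}) (MvPolynomial.X j.succ))) :
    ∃ (X₂ : Scheme.{0}) (π : X₂ ⟶ Spec (.of (MvPolynomial (Fin (n + 1)) k ⧸ Ideal.span {MvPolynomial.rename Fin.succ f}))), IsProper π ∧
      Literature.AlgebraicGeometry.Resolution.IsBirational π ∧
      IsIntegral X₂ ∧ (∀ x : X₂, (∀ d : ℕ, ringKrullDim (X₂.presheaf.stalk x) = d → ∀ s : Fin d → X₂.presheaf.stalk x, (Ideal.span (Set.range s)).radical.IsMaximal → RingTheory.Sequence.IsWeaklyRegular (X₂.presheaf.stalk x) (List.ofFn s))) ∧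
      IsIso (π ∣_ ⟨(closure ({η} : Set ↥(Spec (.of (MvPolynomial (Fin (n + 1)) k ⧸ Ideal.span {MvPolynomial.rename Fin.succ f})))))ᶜ, isClosed_closure.isOpen_compl⟩) ∧
      ∀ x : X₂, π.base x ∈ closure ({η} : Set ↥(Spec (.of (MvPolynomial (Fin (n + 1)) k ⧸ Ideal.span {MvPolynomial.rename Fin.succ f})))) → ¬ IsClosed ({x} : Set X₂) → (IsDomain (X₂.presheaf.stalk x) ∧ ∀ d : ℕ, ringKrullDim (X₂.presheaf.stalk x) = d → ∀ s : Fin d → X₂.presheaf.stalk x, (Ideal.span (Set.range s)).radical.IsMaximal → RingTheory.Sequence.IsWeaklyRegular (X₂.presheaf.stalk x) (List.ofFn s) ∧ ∀ t : X₂.presheaf.stalk x, (∃ e : ℕ, t ^ p ^ e ∈ Ideal.span ((fun z : X₂.presheaf.stalk x => z ^ p ^ e) '' (Ideal.span (Set.range s) : Set (X₂.presheaf.stalk x)))) → t ∈ Ideal.span (Set.range s)) :=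
  CNCylinder.strongPlusStep_cylinder_of_cnData p k n hn A hA0 hprim t ht V hV m hm a haA hgen hge hcov f hfprime hXne hCN dv g
    hg hndiv hface (hoff'_of_hoff p k n f hfprime hoff) η hη

end Summit.ResolutionOfSingularities.ResolutionOfSingularities.Theorems.FInjectiveMacaulayfication.CylinderHoffDischarge

end
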